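import Summits.AtomisticToContinuum.Crystallization.Theorems.ThreeConeCertificateSlackRigidityUniqSums
import Summits.AtomisticToContinuum.Crystallization.Theorems.ExcessDecayLiouvilleCoarseGrainsPinEval
import HarnessLib

/-!
# Weighted hcp lattice sums: soundness of the kernel evaluator and tails
(crux `SlackRigidity`, stmt-AtomisticToContinuum-11960, line `ekeland-surgery-parity`, numerics stub
`stub_hcpShapeUniqueMax` of the reshaped `stub_hcpOptimalCongruent`)

For the weighted sums `hcpSumW m e c = ∑_{v ≠ 0} (k²)ᵐ x_v(c)⁻ᵉ` and their integer evaluator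
`hcpSumFloorSumW` (`…SlackRigidityUniqSums`) we prove, mirroring the tree's `…CoarseGrainsPinEval`:

* `hcpSumTermW_le_unweighted`: `(k²)ᵐ x⁻ᵉ ≤ (c²)⁻ᵐ · x⁻⁽ᵉ⁻ᵐ⁾` (since `k²c² ≤ x`), whence summability,
  nonnegativity, antitonicity in `c`, and TAILS of the weighted sums from the unweighted cube tails
  (`hcpSumW_le_cube_add`, tail bound entering as a hypothesis so that either the tree's `c² ≥ 3/5` tail
  or its general-ratio version can be plugged in);
* soundness of the evaluator at rational `c = p/q`: `⌊M(k²)ᵐ/Nᵉ⌋` brackets `M(k²)ᵐ/Nᵉ` within `1`, the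
  structural loops are `Finset.range` sums over the re-indexed cube, so
  `(3q²)ᵉ·FSW/M ≤ hcpSumW m e (p/q)` (`hcpSumW_ge_certW`) and
  `hcpSumW m e (p/q) ≤ (3q²)ᵉ(FSW + (2K+1)³)/M + (weighted tail)` (`hcpSumW_le_certW`).

All `[folklore]` numerics bookkeeping.
-/

noncomputable section

namespace Summit.AtomisticToContinuum.Crystallization.Theorems.EkelandSurgeryParityUniq

open Finset
open Summit.AtomisticToContinuum.Crystallization.Theorems.ExcessDecayLiouvilleCoarseGrains

/-! ## The weighted terms against the unweighted ones -/

/-- The weighted term is the weight times the plain term. [folklore] -/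
theorem hcpSumTermW_eq_mul (m e : ℕ) (c : ℝ) (v : ℤ × ℤ × ℤ) :
    hcpSumTermW m e c v = ((v.1 : ℝ) ^ 2) ^ m * hcpSumTerm e c v := by
  unfold hcpSumTermW hcpSumTerm
  split_ifs <;> simp

/-- **Weight against decay**: for `m ≤ e` and `c ≠ 0`, `(k²)ᵐ x⁻ᵉ ≤ (c²)⁻ᵐ x⁻⁽ᵉ⁻ᵐ⁾`. [folklore] -/
theorem hcpSumTermW_le_unweighted {m e : ℕ} (hme : m ≤ e) {c : ℝ} (hc : c ≠ 0) (v : ℤ × ℤ × ℤ) :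
    hcpSumTermW m e c v ≤ ((c ^ 2)⁻¹) ^ m * hcpSumTerm (e - m) c v := by
  unfold hcpSumTermW hcpSumTerm
  split_ifs with hv
  · simp
  · have hQ := hcpSumQ_nonneg v
    have hx : 0 < hcpSumQ v + (v.1 : ℝ) ^ 2 * c ^ 2 := hcpSum_r_pos hv hc
    have hc2 : 0 < c ^ 2 := by positivity
    -- `k² x⁻¹ ≤ (c²)⁻¹`
    have hk : (v.1 : ℝ) ^ 2 * (hcpSumQ v + (v.1 : ℝ) ^ 2 * c ^ 2)⁻¹ ≤ (c ^ 2)⁻¹ := by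
      rw [← div_eq_mul_inv, div_le_iff₀ hx, inv_mul_eq_div, le_div_iff₀ hc2]
      nlinarith
    have hsplit : ((hcpSumQ v + (v.1 : ℝ) ^ 2 * c ^ 2)⁻¹) ^ e =
        ((hcpSumQ v + (v.1 : ℝ) ^ 2 * c ^ 2)⁻¹) ^ m * ((hcpSumQ v + (v.1 : ℝ) ^ 2 * c ^ 2)⁻¹) ^ (e - m) := by
      rw [← pow_add, Nat.add_sub_cancel' hme]
    rw [hsplit, ← mul_assoc, ← mul_pow]
    exact mul_le_mul_of_nonneg_right (pow_le_pow_left₀ (by positivity) hk m) (by positivity)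

/-- The weighted terms are antitone in `c > 0`. [folklore] -/
theorem hcpSumTermW_antitone (m : ℕ) {e : ℕ} {c₁ c₂ : ℝ} (h₁ : 0 < c₁) (h₁₂ : c₁ ≤ c₂) (v : ℤ × ℤ × ℤ) :
    hcpSumTermW m e c₂ v ≤ hcpSumTermW m e c₁ v := by
  rw [hcpSumTermW_eq_mul, hcpSumTermW_eq_mul]
  exact mul_le_mul_of_nonneg_left (hcpSumTerm_antitone h₁ h₁₂ v) (by positivity)

/-- **Summability** of the weighted family from that of the plain family of exponent `e − m`. [folklore] -/
theorem hcpSumTermW_summable {m e : ℕ} (hme : m ≤ e) {c : ℝ} (hc : c ≠ 0)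
    (hs : Summable (hcpSumTerm (e - m) c)) : Summable (hcpSumTermW m e c) :=
  Summable.of_nonneg_of_le (fun v => hcpSumTermW_nonneg m e c v)
    (fun v => hcpSumTermW_le_unweighted hme hc v) (hs.mul_left _)

/-- The weighted sums are nonnegative. [folklore] -/
theorem hcpSumW_nonneg (m e : ℕ) (c : ℝ) : 0 ≤ hcpSumW m e c :=
  tsum_nonneg fun v => hcpSumTermW_nonneg m e c v

/-- **Antitonicity** of the weighted sums in `c > 0` (given summability at both ratios). [folklore] -/
theorem hcpSumW_antitone {m e : ℕ} {c₁ c₂ : ℝ} (h₁ : 0 < c₁) (h₁₂ : c₁ ≤ c₂)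
    (hs₁ : Summable (hcpSumTermW m e c₁)) (hs₂ : Summable (hcpSumTermW m e c₂)) :
    hcpSumW m e c₂ ≤ hcpSumW m e c₁ :=
  hs₂.tsum_le_tsum (hcpSumTermW_antitone m h₁ h₁₂) hs₁

/-- Any finite partial sum is below the weighted sum. [folklore] -/
theorem hcpSumW_sum_le {m e : ℕ} {c : ℝ} (hs : Summable (hcpSumTermW m e c)) (s : Finset (ℤ × ℤ × ℤ)) :
    ∑ v ∈ s, hcpSumTermW m e c v ≤ hcpSumW m e c :=
  hs.sum_le_tsum s fun v _ => hcpSumTermW_nonneg m e c v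

/-- **Cube plus tail** for the weighted sums: if the cube tails of the PLAIN sum of exponent `e − m` are
below `T` (any of the tree's tail bounds), then `hcpSumW m e c ≤ ∑_{cube K} termW + (c²)⁻ᵐ · T`. [folklore] -/
theorem hcpSumW_le_cube_add {m e : ℕ} (hme : m ≤ e) {c : ℝ} (hc : c ≠ 0) {K : ℕ} {T : ℝ}
    (htail : ∀ K', K ≤ K' → ∑ v ∈ hcpSumCube K' \ hcpSumCube K, hcpSumTerm (e - m) c v ≤ T) :
    hcpSumW m e c ≤ ∑ v ∈ hcpSumCube K, hcpSumTermW m e c v + ((c ^ 2)⁻¹) ^ m * T := by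
  have hfac : 0 ≤ ((c ^ 2)⁻¹) ^ m := by positivity
  refine Real.tsum_le_of_sum_le (fun v => hcpSumTermW_nonneg m e c v) fun s => ?_
  obtain ⟨K', hKK', hs⟩ := hcpSum_exists_subset_hcpSumCube s K
  calc ∑ v ∈ s, hcpSumTermW m e c v
      ≤ ∑ v ∈ hcpSumCube K', hcpSumTermW m e c v :=
        Finset.sum_le_sum_of_subset_of_nonneg hs fun v _ _ => hcpSumTermW_nonneg m e c v
    _ = ∑ v ∈ hcpSumCube K' \ hcpSumCube K, hcpSumTermW m e c v + ∑ v ∈ hcpSumCube K, hcpSumTermW m e c v :=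
        (Finset.sum_sdiff (hcpSumCube_mono hKK')).symm
    _ ≤ ((c ^ 2)⁻¹) ^ m * T + ∑ v ∈ hcpSumCube K, hcpSumTermW m e c v := by
        gcongr
        calc ∑ v ∈ hcpSumCube K' \ hcpSumCube K, hcpSumTermW m e c v
            ≤ ∑ v ∈ hcpSumCube K' \ hcpSumCube K, ((c ^ 2)⁻¹) ^ m * hcpSumTerm (e - m) c v :=
              Finset.sum_le_sum fun v _ => hcpSumTermW_le_unweighted hme hc v
          _ = ((c ^ 2)⁻¹) ^ m * ∑ v ∈ hcpSumCube K' \ hcpSumCube K, hcpSumTerm (e - m) c v := by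
              rw [Finset.mul_sum]
          _ ≤ ((c ^ 2)⁻¹) ^ m * T := mul_le_mul_of_nonneg_left (htail K' hKK') hfac
    _ = _ := add_comm _ _

/-! ## The integer evaluator: soundness -/

/-- The integer weight as a real: `(k²)ᵐ` with `k = kk − K`. [folklore] -/
theorem hcpSumWeightN_cast (K m kk : ℕ) :
    ((hcpSumWeightN K m kk : ℕ) : ℝ) = (((kk : ℝ) - K) ^ 2) ^ m := by
  unfold hcpSumWeightN
  have h0 : (0 : ℤ) ≤ ((kk : ℤ) - K) ^ 2 := sq_nonneg _
  have h1 : ((((kk : ℤ) - K) ^ 2).toNat : ℤ) = ((kk : ℤ) - K) ^ 2 := Int.toNat_of_nonneg h0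
  have h2 : (((((kk : ℤ) - K) ^ 2).toNat : ℕ) : ℝ) = ((kk : ℝ) - K) ^ 2 := by
    rw [← Int.cast_natCast (R := ℝ), h1]
    push_cast
    ring
  rw [Nat.cast_pow, h2]

/-- The weighted term at `c = p/q` in terms of the numerator. [folklore] -/
theorem hcpSumTermW_eq_of_rat (p : ℕ) {q : ℕ} (hq : 0 < q) (m e : ℕ) (v : ℤ × ℤ × ℤ) :
    hcpSumTermW m e ((p : ℝ) / q) v =
      (3 * (q : ℝ) ^ 2) ^ e * (((v.1 : ℝ) ^ 2) ^ m *
        (if v = 0 then 0 else (((hcpSumNumZ p q v.1 v.2.1 v.2.2 : ℝ))⁻¹) ^ e)) := by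
  rw [hcpSumTermW_eq_mul, hcpSumTerm_eq_of_rat p hq e v]
  ring

/-- Upper floor bound for one weighted term. [folklore] -/
theorem hcpSumFloorTermW_le {p q : ℕ} (hp : 0 < p) (hq : 0 < q) (K m e M kk ii jj : ℕ) :
    (hcpSumFloorTermW p q K m e M kk ii jj : ℝ) ≤
      M * ((((kk : ℝ) - K) ^ 2) ^ m *
        (if (((kk : ℤ) - K, (ii : ℤ) - K, (jj : ℤ) - K) : ℤ × ℤ × ℤ) = 0 then 0
          else (((hcpSumNumZ p q ((kk : ℤ) - K) ((ii : ℤ) - K) ((jj : ℤ) - K) : ℝ))⁻¹) ^ e)) := by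
  unfold hcpSumFloorTermW
  by_cases h0 : kk = K ∧ ii = K ∧ jj = K
  · rw [if_pos h0]
    obtain ⟨rfl, rfl, rfl⟩ := h0
    simp
  · rw [if_neg h0]
    have hv : (((kk : ℤ) - K, (ii : ℤ) - K, (jj : ℤ) - K) : ℤ × ℤ × ℤ) ≠ 0 := by
      intro h
      simp only [Prod.mk_eq_zero, sub_eq_zero] at h
      omega
    rw [if_neg hv]
    have hN := hcpSumNumZ_pos hp hq hv
    set N := hcpSumNumZ p q ((kk : ℤ) - K) ((ii : ℤ) - K) ((jj : ℤ) - K) with hNdef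
    have hNc : ((N.toNat : ℕ) : ℝ) = (N : ℝ) := by
      have : ((N.toNat : ℕ) : ℤ) = N := Int.toNat_of_nonneg hN.le
      exact_mod_cast this
    have hd : (0 : ℝ) < (N : ℝ) ^ e := by
      have : (0 : ℝ) < (N : ℝ) := by exact_mod_cast hN
      positivity
    calc ((M * hcpSumWeightN K m kk / N.toNat ^ e : ℕ) : ℝ)
        ≤ ((M * hcpSumWeightN K m kk : ℕ) : ℝ) / ((N.toNat ^ e : ℕ) : ℝ) := Nat.cast_div_le
      _ = M * ((((kk : ℝ) - K) ^ 2) ^ m * ((N : ℝ)⁻¹) ^ e) := by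
          rw [Nat.cast_pow, hNc, Nat.cast_mul, hcpSumWeightN_cast, inv_pow, div_eq_mul_inv, mul_assoc]

/-- Lower floor bound for one weighted term. [folklore] -/
theorem hcpSum_le_hcpSumFloorTermW_add_one {p q : ℕ} (hp : 0 < p) (hq : 0 < q) (K m e M kk ii jj : ℕ) :
    M * ((((kk : ℝ) - K) ^ 2) ^ m *
        (if (((kk : ℤ) - K, (ii : ℤ) - K, (jj : ℤ) - K) : ℤ × ℤ × ℤ) = 0 then 0
          else (((hcpSumNumZ p q ((kk : ℤ) - K) ((ii : ℤ) - K) ((jj : ℤ) - K) : ℝ))⁻¹) ^ e)) ≤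
      (hcpSumFloorTermW p q K m e M kk ii jj : ℝ) + 1 := by
  unfold hcpSumFloorTermW
  by_cases h0 : kk = K ∧ ii = K ∧ jj = K
  · rw [if_pos h0]
    obtain ⟨rfl, rfl, rfl⟩ := h0
    simp
  · rw [if_neg h0]
    have hv : (((kk : ℤ) - K, (ii : ℤ) - K, (jj : ℤ) - K) : ℤ × ℤ × ℤ) ≠ 0 := by
      intro h
      simp only [Prod.mk_eq_zero, sub_eq_zero] at h
      omega
    rw [if_neg hv]
    have hN := hcpSumNumZ_pos hp hq hv
    set N := hcpSumNumZ p q ((kk : ℤ) - K) ((ii : ℤ) - K) ((jj : ℤ) - K) with hNdef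
    have hNc : ((N.toNat : ℕ) : ℝ) = (N : ℝ) := by
      have : ((N.toNat : ℕ) : ℤ) = N := Int.toNat_of_nonneg hN.le
      exact_mod_cast this
    have hNpos : (0 : ℝ) < (N : ℝ) := by exact_mod_cast hN
    set d : ℕ := N.toNat ^ e with hddef
    have hdc : (d : ℝ) = (N : ℝ) ^ e := by rw [hddef, Nat.cast_pow, hNc]
    have hdpos : (0 : ℝ) < d := by rw [hdc]; positivity
    set A : ℕ := M * hcpSumWeightN K m kk with hAdef
    have hAc : (A : ℝ) = M * ((((kk : ℝ) - K) ^ 2) ^ m) := by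
      rw [hAdef, Nat.cast_mul, hcpSumWeightN_cast]
    have hdiv := Nat.div_add_mod A d
    have hmod := Nat.mod_lt A (show 0 < d by exact_mod_cast hdpos)
    have hreal : (A : ℝ) < (d : ℝ) * ((A / d : ℕ) : ℝ) + d := by
      have : (A : ℝ) = (d : ℝ) * ((A / d : ℕ) : ℝ) + ((A % d : ℕ) : ℝ) := by exact_mod_cast hdiv.symm
      have h2 : ((A % d : ℕ) : ℝ) < d := by exact_mod_cast hmod
      linarith
    have key : (M : ℝ) * ((((kk : ℝ) - K) ^ 2) ^ m * ((N : ℝ)⁻¹) ^ e) = (A : ℝ) / d := by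
      rw [hAc, hdc, inv_pow, div_eq_mul_inv, mul_assoc]
    rw [key, div_le_iff₀ hdpos]
    nlinarith

/-- The inner weighted loop is a `Finset.range` sum. [folklore] -/
theorem hcpSumLoopJW_eq (p q K m e M kk ii n : ℕ) :
    hcpSumLoopJW p q K m e M kk ii n = ∑ jj ∈ Finset.range n, hcpSumFloorTermW p q K m e M kk ii jj := by
  induction n with
  | zero => rfl
  | succ n ih => rw [hcpSumLoopJW, ih, Finset.sum_range_succ]

/-- The middle weighted loop is a `Finset.range` sum. [folklore] -/
theorem hcpSumLoopIW_eq (p q K m e M kk n : ℕ) :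
    hcpSumLoopIW p q K m e M kk n =
      ∑ ii ∈ Finset.range n, ∑ jj ∈ Finset.range (2 * K + 1), hcpSumFloorTermW p q K m e M kk ii jj := by
  induction n with
  | zero => rfl
  | succ n ih => rw [hcpSumLoopIW, ih, Finset.sum_range_succ, hcpSumLoopJW_eq]

/-- The outer weighted loop is a `Finset.range` sum. [folklore] -/
theorem hcpSumLoopKW_eq (p q K m e M n : ℕ) :
    hcpSumLoopKW p q K m e M n = ∑ kk ∈ Finset.range n, ∑ ii ∈ Finset.range (2 * K + 1),
      ∑ jj ∈ Finset.range (2 * K + 1), hcpSumFloorTermW p q K m e M kk ii jj := by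
  induction n with
  | zero => rfl
  | succ n ih => rw [hcpSumLoopKW, ih, Finset.sum_range_succ, hcpSumLoopIW_eq]

/-- The weighted floor sum as a triple `Finset.range` sum. [folklore] -/
theorem hcpSumFloorSumW_eq (p q K m e M : ℕ) :
    hcpSumFloorSumW p q K m e M = ∑ kk ∈ Finset.range (2 * K + 1), ∑ ii ∈ Finset.range (2 * K + 1),
      ∑ jj ∈ Finset.range (2 * K + 1), hcpSumFloorTermW p q K m e M kk ii jj :=
  hcpSumLoopKW_eq p q K m e M _

/-- **Weighted floor sum, upper soundness**: `FSW ≤ M · ∑_{cube} (k²)ᵐ [v ≠ 0] N_v^{-e}`. [folklore] -/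
theorem hcpSumFloorSumW_le {p q : ℕ} (hp : 0 < p) (hq : 0 < q) (K m e M : ℕ) :
    (hcpSumFloorSumW p q K m e M : ℝ) ≤
      M * ∑ v ∈ hcpSumCube K, ((v.1 : ℝ) ^ 2) ^ m *
        (if v = 0 then 0 else (((hcpSumNumZ p q v.1 v.2.1 v.2.2 : ℝ))⁻¹) ^ e) := by
  rw [hcpSumFloorSumW_eq, hcpSum_sum_hcpSumCube_eq_sum_range, Finset.mul_sum]
  push_cast
  refine Finset.sum_le_sum fun kk _ => ?_
  rw [Finset.mul_sum]
  refine Finset.sum_le_sum fun ii _ => ?_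
  rw [Finset.mul_sum]
  refine Finset.sum_le_sum fun jj _ => ?_
  exact hcpSumFloorTermW_le hp hq K m e M kk ii jj

/-- **Weighted floor sum, lower soundness**: `M · ∑_{cube} (k²)ᵐ [v ≠ 0] N_v^{-e} ≤ FSW + (2K+1)³`. [folklore] -/
theorem hcpSum_le_hcpSumFloorSumW_add {p q : ℕ} (hp : 0 < p) (hq : 0 < q) (K m e M : ℕ) :
    M * ∑ v ∈ hcpSumCube K, ((v.1 : ℝ) ^ 2) ^ m *
        (if v = 0 then 0 else (((hcpSumNumZ p q v.1 v.2.1 v.2.2 : ℝ))⁻¹) ^ e) ≤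
      (hcpSumFloorSumW p q K m e M : ℝ) + (2 * K + 1) ^ 3 := by
  have hcount : (2 * (K : ℝ) + 1) ^ 3 = ∑ _kk ∈ Finset.range (2 * K + 1),
      ∑ _ii ∈ Finset.range (2 * K + 1), ∑ _jj ∈ Finset.range (2 * K + 1), (1 : ℝ) := by
    simp only [Finset.sum_const, Finset.card_range, nsmul_eq_mul, mul_one]
    push_cast
    ring
  rw [hcpSumFloorSumW_eq, hcpSum_sum_hcpSumCube_eq_sum_range, Finset.mul_sum]
  push_cast
  rw [hcount, ← Finset.sum_add_distrib]
  refine Finset.sum_le_sum fun kk _ => ?_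
  rw [Finset.mul_sum, ← Finset.sum_add_distrib]
  refine Finset.sum_le_sum fun ii _ => ?_
  rw [Finset.mul_sum, ← Finset.sum_add_distrib]
  refine Finset.sum_le_sum fun jj _ => ?_
  exact hcpSum_le_hcpSumFloorTermW_add_one hp hq K m e M kk ii jj

/-- The weighted cube sum at `c = p/q` in terms of the numerators. [folklore] -/
theorem hcpSum_sum_hcpSumCube_hcpSumTermW_eq (p : ℕ) {q : ℕ} (hq : 0 < q) (m e K : ℕ) :
    ∑ v ∈ hcpSumCube K, hcpSumTermW m e ((p : ℝ) / q) v =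
      (3 * (q : ℝ) ^ 2) ^ e * ∑ v ∈ hcpSumCube K, ((v.1 : ℝ) ^ 2) ^ m *
        (if v = 0 then 0 else (((hcpSumNumZ p q v.1 v.2.1 v.2.2 : ℝ))⁻¹) ^ e) := by
  rw [Finset.mul_sum]
  exact Finset.sum_congr rfl fun v _ => hcpSumTermW_eq_of_rat p hq m e v

/-- **Certified lower bound for the weighted sum** at `c = p/q > 0` (given summability):
`(3q²)ᵉ · FSW / M ≤ hcpSumW m e (p/q)`. [folklore] -/
theorem hcpSumW_ge_certW {m e : ℕ} {p q : ℕ} (hp : 0 < p) (hq : 0 < q)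
    (hs : Summable (hcpSumTermW m e ((p : ℝ) / q))) (K : ℕ) {M : ℕ} (hM : 0 < M) :
    (3 * (q : ℝ) ^ 2) ^ e * (hcpSumFloorSumW p q K m e M : ℝ) / M ≤ hcpSumW m e ((p : ℝ) / q) := by
  refine le_trans ?_ (hcpSumW_sum_le hs (hcpSumCube K))
  rw [hcpSum_sum_hcpSumCube_hcpSumTermW_eq p hq, mul_div_assoc]
  refine mul_le_mul_of_nonneg_left ?_ (by positivity)
  rw [div_le_iff₀ (by exact_mod_cast hM)]
  have := hcpSumFloorSumW_le hp hq K m e M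
  linarith

/-- **Certified upper bound for the weighted sum** at `c = p/q > 0`: the cube part by the evaluator, the
tail by the plain tail bound `T` of exponent `e − m` (hypothesis) times `(c²)⁻ᵐ`. [folklore] -/
theorem hcpSumW_le_certW {m e : ℕ} (hme : m ≤ e) {p q : ℕ} (hp : 0 < p) (hq : 0 < q)
    {K : ℕ} {T : ℝ}
    (htail : ∀ K', K ≤ K' →
      ∑ v ∈ hcpSumCube K' \ hcpSumCube K, hcpSumTerm (e - m) ((p : ℝ) / q) v ≤ T)
    {M : ℕ} (hM : 0 < M) :
    hcpSumW m e ((p : ℝ) / q) ≤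
      (3 * (q : ℝ) ^ 2) ^ e * ((hcpSumFloorSumW p q K m e M : ℝ) + (2 * K + 1) ^ 3) / M +
        ((((p : ℝ) / q) ^ 2)⁻¹) ^ m * T := by
  have hc : ((p : ℝ) / q) ≠ 0 := by positivity
  refine le_trans (hcpSumW_le_cube_add hme hc htail) ?_
  rw [hcpSum_sum_hcpSumCube_hcpSumTermW_eq p hq]
  refine add_le_add_left ?_ _
  rw [mul_div_assoc]
  refine mul_le_mul_of_nonneg_left ?_ (by positivity)
  rw [le_div_iff₀ (by exact_mod_cast hM)]
  have := hcpSum_le_hcpSumFloorSumW_add hp hq K m e M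
  linarith

/-- Anchor (registered sub-goal `uniqWSound_anchor` of stmt-AtomisticToContinuum-11960): the weighted
term is the weight times the plain term. [folklore] -/
theorem uniqWSound_anchor :
    ∀ (m e : ℕ) (c : ℝ) (v : ℤ × ℤ × ℤ), hcpSumTermW m e c v = ((v.1 : ℝ) ^ 2) ^ m * hcpSumTerm e c v :=
  hcpSumTermW_eq_mul

end Summit.AtomisticToContinuum.Crystallization.Theorems.EkelandSurgeryParityUniq

end
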